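import Summits.CriticalPhenomena.PercolationContinuityZ3.Theorems.PercNearOneGluingNoHeavyQuantHeavyTopSDEC
import Summits.CriticalPhenomena.PercolationContinuityZ3.Theorems.PercNearOneGluingNoHeavyQuantGatedConvReduction
import Summits.CriticalPhenomena.PercolationContinuityZ3.Theorems.PercNearOneGluingNoHeavyQuantLightSliceWideHolds
import HarnessLib

/-!
# QUANT lane R8, T-DEC: THE CONVOLUTION OF TWO HEAVY-TOP LAWS IS GATE-STABLE DEC — every forest that is the union of two
# caterpillars (at a common floor) is SDEC, unconditionally; the kernel engine of the "pair hull" route to `Quant.FarTreeRow`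

builds on p205010 (kernel theorem, internal audit signed; external expert review pending)

Support file (`--supports stmt-CriticalPhenomena-4575`), QUANT lane typer seat prim-quant-stmt (gen 35), rung R8 of
`run/shared/lean/prim/quant/LADDER.md`; memo `run/shared/lean/prim/quant/prim-quant-stmt-g35/GATESTABLE-G35.md` §6.  Theorems only,
standard axioms, no sorries.  Uses: `LawDec.sdec_of_top_ge` (typer g35, heavy-top laws are SDEC), Conjecture R as a theorem
(`gatedShift_sdecUpTo`, typer g26), typer g25's split identity and its bookkeeping (`gate_lconv_split`, `posPart`, `coPart`,
`posPart_laws`, `coPart_laws`), `ConvClosedT` as a theorem (`convClosedT_holds`, census-2 g59–g61 / lead) through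
`decAt_lconv_of_convClosedT`, and `decAtT_mixture`.

THE THEOREM (`LawDec.sdec_lconv_of_top_ge`).  For `0 < y < 1` and probability laws `μ₁` on `{0..M₁}`, `μ₂` on `{0..M₂}` whose TOP ATOMS
carry mass `μ₁ M₁ ≥ y`, `μ₂ M₂ ≥ y`, the convolution `lconv M₁ M₂ μ₁ μ₂` is top-affordable and `SDEC y (M₁+M₂)`: for every gate
`0 < q ≤ 1` and every layer `j′ < M₁ + M₂`, `gate (lconv μ₁ μ₂) q` is DEC(j′) at floor `q·y`.  TREE READING: a forest consisting of two
caterpillars (each relay marginal `≥ y`) has a gate-stable DEC count law; with typer g26's spines and `sdec_of_top_ge` this is the first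
BRANCHING family settled by the law-level calculus at EVERY floor (light floors included).

THE PROOF (typer g35) is typer g25's `sdec_lconv_of_le` with Conjecture E replaced by an induction on `M₁ + M₂`: writing `p = μ₁ 0 ≤ μ₂ 0`,
`gate_q(μ₁ ∗ μ₂)` is the explicit mixture (`gate_lconv_split`) of `gate_q μ₁ ∗ gate_q μ₂` — DEC at floor `qy` by `ConvClosedT` since both
gated factors are DEC at every layer (`sdec_of_top_ge`) — and of `gate_{q(1−p)}(posPart μ₁ ∗ coPart μ₁ μ₂)`, where `posPart μ₁` and
`coPart μ₁ μ₂` are again HEAVY-TOP laws at the floor `y/(1−p)` (their top masses are divided by `1 − p`), and `posPart μ₁` has NO atom at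
`0`; an empty-free heavy-top factor is `ν(· − 1)` for the heavy-top law `ν s = μ (s+1)` on `{0..M−1}` (`peel_laws` with gate `1`), so
Conjecture R (`gatedShift_sdecUpTo`) reduces to the pair `(ν, ·)` of total support `M₁ + M₂ − 1` — the induction hypothesis — through
the commutation `lconv (ν(·−1)) μ₂ = (lconv ν μ₂)(·−1)` (`lconv_shift_left`).  Degenerate corners: `M₁ = 0` (`lconv δ₀ μ₂ = μ₂`), and
`y = 1 − p` exactly (then both transformed factors are points and the second term is a block, `sdec_gate_point`).

WHY (the PAIR-HULL route, typer g35 STATEMENTS §AO/§AP): numerically (HiGHS with exact-pricing column generation, kit j229093 / j229157 /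
j229360) every tested forest law at a floor `x ≤ 1/2` is a convex combination of laws `ν ∗ ν′` with `ν, ν′` heavy-top at `x` and the same
mean; by this file each such product is SDEC, and DECAtT is convex at a fixed target (`decAtT_mixture`), so `TreeBuilt ⊆ conv(HT ∗ HT)`
(conjecture `HeavyPairHull`, typed separately) would give `SDEC` of every tree-built law, hence `Quant.FarTreeRow`, at light floors —
complementary to the heavy half (`TLBGateConvClosedHeavy`, floors `≥ 1/2`).  HONEST STATUS: `HeavyPairHull`, `SDECConvClosed`,
`GatedConvEmptyFree`, `FarTreeRow` remain OPEN; this file is unconditional but covers only two-caterpillar forests.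

[this work]; Conjecture R: typer g25/g26; split identity: typer g25; `ConvClosedT`: this lane (lead g22 statement; proof census-2/lead
2026-08-22/23).  Nothing here is cited as a published result.  The gluing rows served [cite: KozmaNitzan2024, Conjecture 3 (p. 15)];
product measure [cite: Grimmett1999, §1.3 p. 10].
-/

noncomputable section

namespace Summit.CriticalPhenomena.PercolationContinuityZ3.Theorems

namespace Quant

open Finset

namespace LawDec

/-! ### Shifting commutes with convolution -/

/-- for fixed `s`, the inner indicator sum of `lconv` collapses: `Σ_{i ≤ N} [i + s = t]·f i = [s ≤ t ∧ t − s ≤ N]·f (t − s)`. [this work] -/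
theorem sum_ite_add_eq (N s t : ℕ) (f : ℕ → ℝ) :
    ∑ i ∈ Finset.range (N + 1), (if i + s = t then f i else 0) = if s ≤ t ∧ t - s ≤ N then f (t - s) else 0 := by
  by_cases h : s ≤ t ∧ t - s ≤ N
  · rw [if_pos h]
    rw [Finset.sum_eq_single (t - s)]
    · rw [if_pos (by omega)]
    · intro i _ hi; rw [if_neg (by omega)]
    · intro hn; exfalso; exact hn (Finset.mem_range.2 (by omega))
  · rw [if_neg h]
    refine Finset.sum_eq_zero fun i hi => ?_
    rw [Finset.mem_range] at hi
    rw [if_neg (by omega)]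

/-- **shifting the first factor by one shifts the convolution by one**:
`lconv (M₁+1) M₂ (μ₁(·−1)) μ₂ = (lconv M₁ M₂ μ₁ μ₂)(·−1)`. [this work] -/
theorem lconv_shift_left (M₁ M₂ : ℕ) (μ₁ μ₂ : ℕ → ℝ) :
    lconv (M₁ + 1) M₂ (fun t => if 1 ≤ t then μ₁ (t - 1) else 0) μ₂
      = fun t => if 1 ≤ t then lconv M₁ M₂ μ₁ μ₂ (t - 1) else 0 := by
  funext t
  simp only [lconv]
  rw [Finset.sum_comm]
  have inner : ∀ s ∈ Finset.range (M₂ + 1),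
      ∑ i ∈ Finset.range (M₁ + 1 + 1), (if i + s = t then (if 1 ≤ i then μ₁ (i - 1) else 0) * μ₂ s else 0)
        = if s + 1 ≤ t ∧ t - s - 1 ≤ M₁ then μ₁ (t - s - 1) * μ₂ s else 0 := by
    intro s _
    rw [sum_ite_add_eq (M₁ + 1) s t (fun i => (if 1 ≤ i then μ₁ (i - 1) else 0) * μ₂ s)]
    by_cases h1 : s + 1 ≤ t ∧ t - s - 1 ≤ M₁
    · rw [if_pos (by omega), if_pos h1, if_pos (by omega), show t - s - 1 = t - s - 1 by rfl]
    · by_cases h2 : s ≤ t ∧ t - s ≤ M₁ + 1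
      · rw [if_pos h2, if_neg h1]
        have : ¬ (1 ≤ t - s) ∨ ¬ (t - s - 1 ≤ M₁) := by omega
        rcases this with h | h
        · rw [if_neg h, zero_mul]
        · exfalso; omega
      · rw [if_neg h2, if_neg h1]
  rw [Finset.sum_congr rfl inner]
  by_cases ht : 1 ≤ t
  · rw [if_pos ht, Finset.sum_comm]
    refine Finset.sum_congr rfl fun s hs => ?_
    rw [sum_ite_add_eq M₁ s (t - 1) (fun i => μ₁ i * μ₂ s)]
    by_cases h : s + 1 ≤ t ∧ t - s - 1 ≤ M₁
    · rw [if_pos h, if_pos (by omega), show t - 1 - s = t - s - 1 by omega]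
    · rw [if_neg h, if_neg (by omega)]
  · rw [if_neg ht]
    refine Finset.sum_eq_zero fun s _ => ?_
    rw [if_neg (by omega)]

/-! ### The induction -/

/-- law facts of a heavy-top law: `μ M ≥ y > 0` forces `μ 0 < 1` unless `M = 0`, and `y ≤ 1 − μ 0`. [this work] -/
theorem top_le_one_sub_zero (M : ℕ) (μ : ℕ → ℝ) (hμ0 : ∀ h, 0 ≤ μ h) (hμ1 : ∑ h ∈ Finset.range (M + 1), μ h = 1)
    (hM : 1 ≤ M) : μ M ≤ 1 - μ 0 := by
  have h := hμ1
  obtain ⟨K, rfl⟩ : ∃ K, M = K + 1 := ⟨M - 1, by omega⟩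
  rw [Finset.sum_range_succ', Finset.sum_range_succ] at h
  have hrest : 0 ≤ ∑ s ∈ Finset.range K, μ (s + 1) := Finset.sum_nonneg fun s _ => hμ0 _
  linarith

set_option maxHeartbeats 400000 in
/-- **THE CONVOLUTION OF TWO HEAVY-TOP LAWS IS TOP-AFFORDABLE AND GATE-STABLE DEC** (induction on `M₁ + M₂`; see the module
docstring for the architecture). [this work] -/
theorem sdec_lconv_of_top_ge : ∀ (n : ℕ) (M₁ M₂ : ℕ) (y : ℝ) (μ₁ μ₂ : ℕ → ℝ), M₁ + M₂ = n → 0 < y → y < 1 →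
    (∀ h, 0 ≤ μ₁ h) → (∀ h, M₁ < h → μ₁ h = 0) → (∑ h ∈ Finset.range (M₁ + 1), μ₁ h = 1) → y ≤ μ₁ M₁ →
    (∀ h, 0 ≤ μ₂ h) → (∀ h, M₂ < h → μ₂ h = 0) → (∑ h ∈ Finset.range (M₂ + 1), μ₂ h = 1) → y ≤ μ₂ M₂ →
    y * ((M₁ + M₂ : ℕ) : ℝ) ≤ (∑ h ∈ Finset.range (M₁ + M₂ + 1), (h : ℝ) * lconv M₁ M₂ μ₁ μ₂ h) ∧
      SDEC y (M₁ + M₂) (lconv M₁ M₂ μ₁ μ₂) := by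
  intro n
  induction n using Nat.strong_induction_on with
  | _ n ih =>
  -- (1) the EMPTY-FREE case at size `n` (first factor without atom at 0), from the induction hypothesis below `n`
  have emptyfree : ∀ (M₁ M₂ : ℕ) (y : ℝ) (μ₁ μ₂ : ℕ → ℝ), M₁ + M₂ = n → 0 < y → y < 1 →
      (∀ h, 0 ≤ μ₁ h) → (∀ h, M₁ < h → μ₁ h = 0) → (∑ h ∈ Finset.range (M₁ + 1), μ₁ h = 1) → y ≤ μ₁ M₁ →
      (∀ h, 0 ≤ μ₂ h) → (∀ h, M₂ < h → μ₂ h = 0) → (∑ h ∈ Finset.range (M₂ + 1), μ₂ h = 1) → y ≤ μ₂ M₂ →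
      μ₁ 0 = 0 →
      y * ((M₁ + M₂ : ℕ) : ℝ) ≤ (∑ h ∈ Finset.range (M₁ + M₂ + 1), (h : ℝ) * lconv M₁ M₂ μ₁ μ₂ h) ∧
        SDEC y (M₁ + M₂) (lconv M₁ M₂ μ₁ μ₂) := by
    intro M₁ M₂ y μ₁ μ₂ hn hy0 hy1 h10 h1M h11 ht1 h20 h2M h21 ht2 hz
    -- `M₁ ≥ 1` since `μ₁ 0 = 0` and the mass is `1`
    obtain ⟨K, rfl⟩ : ∃ K, M₁ = K + 1 := by
      rcases Nat.eq_zero_or_pos M₁ with h | h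
      · exfalso; subst h; rw [Finset.sum_range_one] at h11; rw [hz] at h11; exact zero_ne_one h11
      · exact ⟨M₁ - 1, by omega⟩
    -- peel one sure relay: `μ₁ = ν(· − 1)` with `ν s = μ₁ (s+1)` (gate `1 − μ₁ 0 = 1`)
    have hq : 0 < 1 - μ₁ 0 := by rw [hz]; norm_num
    obtain ⟨n0, zM, s1, hgate⟩ := peel_laws K μ₁ h10 h1M h11 hq
    have hmean := peel_mean K μ₁ h11 hq
    rw [hz, sub_zero] at n0 zM s1 hgate hmean
    rw [gate_one, one_mul] at *
    set ν : ℕ → ℝ := fun s => μ₁ (s + 1) / 1 with hν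
    have hνtop : y ≤ ν K := by rw [hν]; beta_reduce; rw [div_one]; exact ht1
    -- induction hypothesis for the pair `(ν, μ₂)` of total support `K + M₂ < n`
    obtain ⟨taIH, sdIH⟩ := ih (K + M₂) (by omega) K M₂ y ν μ₂ rfl hy0 hy1 n0 zM s1 hνtop h20 h2M h21 ht2
    -- law facts of `lconv ν μ₂`
    have L0 : ∀ h, 0 ≤ lconv K M₂ ν μ₂ h := lconv_nonneg K M₂ ν μ₂ n0 h20
    have LM : ∀ h, K + M₂ < h → lconv K M₂ ν μ₂ h = 0 := fun h hh => lconv_eq_zero K M₂ ν μ₂ h hh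
    have L1 : ∑ h ∈ Finset.range (K + M₂ + 1), lconv K M₂ ν μ₂ h = 1 := sum_lconv K M₂ ν μ₂ s1 h21
    -- Conjecture R: one sure relay in front of `lconv ν μ₂`
    have hR := gatedShift_sdecUpTo y 1 1 (K + M₂) (lconv K M₂ ν μ₂) hy0 hy1.le le_rfl (by linarith) le_rfl L0 LM L1 taIH
      ((sdecUpTo_one_iff y (K + M₂) _).2 sdIH)
    have hshift : (fun t => if 1 ≤ t then lconv K M₂ ν μ₂ (t - 1) else 0) = lconv (K + 1) M₂ μ₁ μ₂ := by
      rw [← lconv_shift_left K M₂ ν μ₂, hgate]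
    rw [hshift, show 1 + (K + M₂) = K + 1 + M₂ by omega] at hR
    refine ⟨?_, (sdecUpTo_one_iff y (K + 1 + M₂) _).1 hR⟩
    -- top-affordability of the product: means add
    rw [sum_mul_lconv (K + 1) M₂ μ₁ μ₂ h11 h21, ← hmean]
    have h2mean : y * (M₂ : ℝ) ≤ ∑ h ∈ Finset.range (M₂ + 1), (h : ℝ) * μ₂ h :=
      (sdec_of_top_ge M₂ y μ₂ hy0 hy1 h20 h2M h21 ht2).1
    have hνmean : y * (K : ℝ) ≤ ∑ s ∈ Finset.range (K + 1), (s : ℝ) * ν s :=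
      (sdec_of_top_ge K y ν hy0 hy1 n0 zM s1 hνtop).1
    push_cast
    nlinarith
  -- (2) the general case
  intro M₁ M₂ y μ₁ μ₂ hn hy0 hy1 h10 h1M h11 ht1 h20 h2M h21 ht2
  -- top-affordability of both factors and of the product (means add)
  obtain ⟨hta1, hS1⟩ := sdec_of_top_ge M₁ y μ₁ hy0 hy1 h10 h1M h11 ht1
  obtain ⟨hta2, hS2⟩ := sdec_of_top_ge M₂ y μ₂ hy0 hy1 h20 h2M h21 ht2
  have htaP : y * ((M₁ + M₂ : ℕ) : ℝ) ≤ ∑ h ∈ Finset.range (M₁ + M₂ + 1), (h : ℝ) * lconv M₁ M₂ μ₁ μ₂ h := by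
    rw [sum_mul_lconv M₁ M₂ μ₁ μ₂ h11 h21]; push_cast; nlinarith
  refine ⟨htaP, ?_⟩
  -- WLOG `μ₁ 0 ≤ μ₂ 0` (the statement is symmetric by `lconv_comm`)
  wlog hle : μ₁ 0 ≤ μ₂ 0 generalizing M₁ M₂ μ₁ μ₂
  · have h := this M₂ M₁ μ₂ μ₁ (by omega) h20 h2M h21 ht2 h10 h1M h11 ht1 hta2 hS2 hta1 hS1
      (by rw [sum_mul_lconv M₂ M₁ μ₂ μ₁ h21 h11]; push_cast; nlinarith) (le_of_not_ge hle)
    rw [lconv_comm, show M₁ + M₂ = M₂ + M₁ by omega]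
    exact h
  -- case `μ₁ 0 = 0`: the empty-free case
  by_cases hp0 : μ₁ 0 = 0
  · exact (emptyfree M₁ M₂ y μ₁ μ₂ hn hy0 hy1 h10 h1M h11 ht1 h20 h2M h21 ht2 hp0).2
  -- case `M₁ = 0`: `μ₁ = δ₀` and the product is `μ₂`
  rcases Nat.eq_zero_or_pos M₁ with hM1 | hM1
  · subst hM1
    have hμ1eq : μ₁ = fun i => if i = 0 then (1 : ℝ) else 0 := by
      funext i
      by_cases hi : i = 0
      · subst hi; rw [if_pos rfl]; rw [Finset.sum_range_one] at h11; exact h11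
      · rw [if_neg hi]; exact h1M i (by omega)
    have e : lconv 0 M₂ μ₁ μ₂ = μ₂ := by
      funext h; rw [hμ1eq]; exact lconv_delta_left 0 M₂ μ₂ h2M h
    rw [e, Nat.zero_add]; exact hS2
  -- general case `0 < p = μ₁ 0 < 1`, `M₁ ≥ 1`
  have hpos : 0 < μ₁ 0 := lt_of_le_of_ne (h10 0) (Ne.symm hp0)
  have htop1 : μ₁ M₁ ≤ 1 - μ₁ 0 := top_le_one_sub_zero M₁ μ₁ h10 h11 hM1
  have h1p : 0 < 1 - μ₁ 0 := lt_of_lt_of_le (lt_of_lt_of_le hy0 ht1) htop1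
  have hlt1 : μ₁ 0 < 1 := by linarith
  have hp1 : μ₁ 0 ≠ 1 := ne_of_lt hlt1
  have hyle : y ≤ 1 - μ₁ 0 := ht1.trans htop1
  intro q hq0 hq1 j hj
  set T₁ : ℝ := ∑ h ∈ Finset.range (M₁ + 1), (h : ℝ) * μ₁ h with hT₁
  set T₂ : ℝ := ∑ h ∈ Finset.range (M₂ + 1), (h : ℝ) * μ₂ h with hT₂
  have ha : 0 < 1 - q + q * μ₁ 0 := by nlinarith
  have hqy0 : 0 < q * y := mul_pos hq0 hy0
  have hqy1 : q * y < 1 := by nlinarith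
  -- (A) the plain convolution of the gated factors: `ConvClosedT` (a theorem) at floor `qy`
  obtain ⟨n10, n1M, n11⟩ := gate_laws M₁ μ₁ q hq0.le hq1 h10 h1M h11
  obtain ⟨n20, n2M, n21⟩ := gate_laws M₂ μ₂ q hq0.le hq1 h20 h2M h21
  have hmean1 : ∑ k ∈ Finset.range (M₁ + 1), (k : ℝ) * gate μ₁ q k = q * T₁ := sum_mul_gate μ₁ q M₁
  have hmean2 : ∑ k ∈ Finset.range (M₂ + 1), (k : ℝ) * gate μ₂ q k = q * T₂ := sum_mul_gate μ₂ q M₂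
  have htaν : ∀ (M : ℕ) (μ : ℕ → ℝ) (T : ℝ), (∀ h, M < h → gate μ q h = 0) → y * (M : ℝ) ≤ T →
      (∑ k ∈ Finset.range (M + 1), (k : ℝ) * gate μ q k = q * T) →
      ∀ h, 0 < gate μ q h → q * y * (h : ℝ) ≤ ∑ k ∈ Finset.range (M + 1), (k : ℝ) * gate μ q k := by
    intro M μ T hvan hta hmean h hh
    have hhM : h ≤ M := by
      by_contra hc; exact absurd (hvan h (not_le.1 hc)) (ne_of_gt hh)
    rw [hmean]
    have : q * y * (h : ℝ) ≤ q * y * (M : ℝ) := mul_le_mul_of_nonneg_left (by exact_mod_cast hhM) hqy0.le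
    nlinarith
  have hA : DECAt (q * y) j (M₁ + M₂) (lconv M₁ M₂ (gate μ₁ q) (gate μ₂ q)) :=
    decAt_lconv_of_convClosedT convClosedT_holds (q * y) M₁ M₂ (gate μ₁ q) (gate μ₂ q) hqy0 hqy1 n10 n1M n11 n20 n2M n21
      (htaν M₁ μ₁ T₁ n1M hta1 hmean1) (htaν M₂ μ₂ T₂ n2M hta2 hmean2)
      (fun j'' hj'' => hS1 q hq0 hq1 j'' hj'') (fun j'' hj'' => hS2 q hq0 hq1 j'' hj'') j hj
  -- (B) the empty-free instance: the pair (posPart μ₁, coPart μ₁ μ₂) is HEAVY-TOP at floor `y/(1−p)`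
  obtain ⟨m10, m1M, m11, mmean1, mzero⟩ := posPart_laws M₁ μ₁ h10 h1M h11 hlt1
  obtain ⟨m20, m2M, m21, mmean2⟩ := coPart_laws M₂ μ₁ μ₂ h20 h2M h21 hlt1 hle
  have hy'0 : 0 < y / (1 - μ₁ 0) := div_pos hy0 h1p
  have htop1' : y / (1 - μ₁ 0) ≤ posPart μ₁ M₁ := by
    simp only [posPart]; rw [if_neg (by omega)]
    exact div_le_div_of_nonneg_right ht1 h1p.le
  have htop2' : y / (1 - μ₁ 0) ≤ coPart μ₁ μ₂ M₂ := by
    simp only [coPart]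
    by_cases hM2 : M₂ = 0
    · rw [if_pos hM2]
      have : μ₂ 0 = 1 := by rw [hM2, Finset.sum_range_one] at h21; exact h21
      rw [this, div_le_div_iff_of_pos_right h1p]; exact hyle
    · rw [if_neg hM2]; exact div_le_div_of_nonneg_right ht2 h1p.le
  have hB : DECAt (q * y) j (M₁ + M₂) (gate (lconv M₁ M₂ (posPart μ₁) (coPart μ₁ μ₂)) (q * (1 - μ₁ 0))) := by
    rcases lt_or_eq_of_le hyle with hylt | hyeq
    · -- `y/(1−p) < 1`: the empty-free case at size `n` for the transformed pair, then its gate `q(1−p) ≤ 1`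
      have hy'1 : y / (1 - μ₁ 0) < 1 := by rwa [div_lt_one h1p]
      obtain ⟨-, sdB⟩ := emptyfree M₁ M₂ (y / (1 - μ₁ 0)) (posPart μ₁) (coPart μ₁ μ₂) hn hy'0 hy'1
        m10 m1M m11 htop1' m20 m2M m21 htop2' mzero
      have := sdB (q * (1 - μ₁ 0)) (mul_pos hq0 h1p) (by nlinarith) j hj
      have e : q * (1 - μ₁ 0) * (y / (1 - μ₁ 0)) = q * y := by field_simp
      rw [e] at this
      exact this
    · -- `y = 1 − p`: both transformed factors are points (top mass `1`), the second term is a block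
      have hP1 : posPart μ₁ M₁ = 1 := le_antisymm (by
          have := Finset.single_le_sum (fun h _ => m10 h) (Finset.mem_range.2 (Nat.lt_succ_self M₁))
          rw [m11] at this; exact this) (by
          have : y / (1 - μ₁ 0) = 1 := by rw [hyeq, div_self (ne_of_gt h1p)]
          rw [← this]; exact htop1')
      have hP2 : coPart μ₁ μ₂ M₂ = 1 := le_antisymm (by
          have := Finset.single_le_sum (fun h _ => m20 h) (Finset.mem_range.2 (Nat.lt_succ_self M₂))
          rw [m21] at this; exact this) (by
          have : y / (1 - μ₁ 0) = 1 := by rw [hyeq, div_self (ne_of_gt h1p)]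
          rw [← this]; exact htop2')
      -- a law with full mass on its top is the point mass
      have point : ∀ (M : ℕ) (μ : ℕ → ℝ), (∀ h, 0 ≤ μ h) → (∀ h, M < h → μ h = 0) →
          (∑ h ∈ Finset.range (M + 1), μ h = 1) → μ M = 1 → μ = fun h => if h = M then (1 : ℝ) else 0 := by
        intro M μ hμ0 hμM hμ1 hμtop
        funext h
        by_cases hh : h = M
        · rw [if_pos hh, hh, hμtop]
        · rw [if_neg hh]
          rcases lt_or_gt_of_ne hh with hlt | hgt
          · have hsum : ∑ s ∈ Finset.range M, μ s = 0 := by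
              have e := Finset.sum_range_succ μ M
              rw [hμ1, hμtop] at e; linarith
            exact (Finset.sum_eq_zero_iff_of_nonneg (fun s _ => hμ0 s)).1 hsum h (Finset.mem_range.2 hlt)
          · exact hμM h hgt
      have e1 := point M₁ (posPart μ₁) m10 m1M m11 hP1
      have e2 := point M₂ (coPart μ₁ μ₂) m20 m2M m21 hP2
      have eprod : lconv M₁ M₂ (posPart μ₁) (coPart μ₁ μ₂) = fun h => if h = M₁ + M₂ then (1 : ℝ) else 0 := by
        funext h
        rw [e1, lconv_point_left M₁ M₂ (coPart μ₁ μ₂) m2M h, e2]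
        beta_reduce
        by_cases hle' : M₁ ≤ h
        · rw [if_pos hle']
          by_cases hh : h = M₁ + M₂
          · rw [if_pos (by omega), if_pos hh]
          · rw [if_neg (by omega), if_neg hh]
        · rw [if_neg hle', if_neg (by omega)]
      rw [eprod]
      have hb := sdec_gate_point (q * (1 - μ₁ 0)) (mul_pos hq0 h1p) (by nlinarith) (M₁ + M₂)
      have hb1 := hb 1 one_pos le_rfl j hj
      simp only [gate_gate, one_mul] at hb1
      rw [hyeq]
      exact hb1
  -- targets: all three laws have mean `q(T₁ + T₂)`
  have hτ : ∑ k ∈ Finset.range (M₁ + M₂ + 1), (k : ℝ) * gate (lconv M₁ M₂ μ₁ μ₂) q k = q * (T₁ + T₂) := by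
    rw [sum_mul_gate, sum_mul_lconv M₁ M₂ μ₁ μ₂ h11 h21]
  have hτA : ∑ k ∈ Finset.range (M₁ + M₂ + 1), (k : ℝ) * lconv M₁ M₂ (gate μ₁ q) (gate μ₂ q) k = q * (T₁ + T₂) := by
    rw [sum_mul_lconv M₁ M₂ _ _ n11 n21, hmean1, hmean2]; ring
  have hτB : ∑ k ∈ Finset.range (M₁ + M₂ + 1), (k : ℝ) * gate (lconv M₁ M₂ (posPart μ₁) (coPart μ₁ μ₂)) (q * (1 - μ₁ 0)) k
      = q * (T₁ + T₂) := by
    rw [sum_mul_gate, sum_mul_lconv M₁ M₂ _ _ m11 m21, mmean1, mmean2, hT₁, hT₂]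
    field_simp
  rw [decAt_iff_decAtT, hτA] at hA
  rw [decAt_iff_decAtT, hτB] at hB
  rw [decAt_iff_decAtT, hτ]
  -- the split identity and the mixture
  have hsplit : gate (lconv M₁ M₂ μ₁ μ₂) q = fun h =>
      (μ₁ 0 / (1 - q + q * μ₁ 0)) * lconv M₁ M₂ (gate μ₁ q) (gate μ₂ q) h +
      (1 - μ₁ 0 / (1 - q + q * μ₁ 0)) * gate (lconv M₁ M₂ (posPart μ₁) (coPart μ₁ μ₂)) (q * (1 - μ₁ 0)) h := by
    funext h
    rw [gate_lconv_split M₁ M₂ μ₁ μ₂ q h1M h2M hp1 (ne_of_gt ha) h]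
    congr 1
    have : (1 - q) * (1 - μ₁ 0) / (1 - q + q * μ₁ 0) = 1 - μ₁ 0 / (1 - q + q * μ₁ 0) := by
      field_simp; ring
    rw [this]
  rw [hsplit]
  have hw1 : μ₁ 0 / (1 - q + q * μ₁ 0) ≤ 1 := by
    rw [div_le_one ha]
    have e : 1 - q + q * μ₁ 0 - μ₁ 0 = (1 - q) * (1 - μ₁ 0) := by ring
    have hprod : 0 ≤ (1 - q) * (1 - μ₁ 0) := mul_nonneg (by linarith) h1p.le
    linarith
  exact decAtT_mixture _ (div_nonneg hpos.le ha.le) hw1 hA hB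

/-- **packaged**: for heavy-top laws `μ₁`, `μ₂` at floor `y`, `SDEC y (M₁ + M₂) (lconv M₁ M₂ μ₁ μ₂)`. [this work] -/
theorem sdec_lconv_heavyTop (M₁ M₂ : ℕ) (y : ℝ) (μ₁ μ₂ : ℕ → ℝ) (hy0 : 0 < y) (hy1 : y < 1)
    (h10 : ∀ h, 0 ≤ μ₁ h) (h1M : ∀ h, M₁ < h → μ₁ h = 0) (h11 : ∑ h ∈ Finset.range (M₁ + 1), μ₁ h = 1) (ht1 : y ≤ μ₁ M₁)
    (h20 : ∀ h, 0 ≤ μ₂ h) (h2M : ∀ h, M₂ < h → μ₂ h = 0) (h21 : ∑ h ∈ Finset.range (M₂ + 1), μ₂ h = 1) (ht2 : y ≤ μ₂ M₂) :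
    SDEC y (M₁ + M₂) (lconv M₁ M₂ μ₁ μ₂) :=
  (sdec_lconv_of_top_ge (M₁ + M₂) M₁ M₂ y μ₁ μ₂ rfl hy0 hy1 h10 h1M h11 ht1 h20 h2M h21 ht2).2

/-- **every layer**: the convolution of two heavy-top laws is DEC(j′) at every layer at floor `y`. [this work] -/
theorem decAt_lconv_heavyTop (M₁ M₂ : ℕ) (y : ℝ) (μ₁ μ₂ : ℕ → ℝ) (hy0 : 0 < y) (hy1 : y < 1)
    (h10 : ∀ h, 0 ≤ μ₁ h) (h1M : ∀ h, M₁ < h → μ₁ h = 0) (h11 : ∑ h ∈ Finset.range (M₁ + 1), μ₁ h = 1) (ht1 : y ≤ μ₁ M₁)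
    (h20 : ∀ h, 0 ≤ μ₂ h) (h2M : ∀ h, M₂ < h → μ₂ h = 0) (h21 : ∑ h ∈ Finset.range (M₂ + 1), μ₂ h = 1) (ht2 : y ≤ μ₂ M₂)
    (j' : ℕ) : DECAt y j' (M₁ + M₂) (lconv M₁ M₂ μ₁ μ₂) := by
  obtain ⟨ta, sd⟩ := sdec_lconv_of_top_ge (M₁ + M₂) M₁ M₂ y μ₁ μ₂ rfl hy0 hy1 h10 h1M h11 ht1 h20 h2M h21 ht2
  exact decAt_of_sdec sd hy0 hy1 (lconv_nonneg M₁ M₂ μ₁ μ₂ h10 h20) (fun h hh => lconv_eq_zero M₁ M₂ μ₁ μ₂ h hh)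
    (sum_lconv M₁ M₂ μ₁ μ₂ h11 h21) ta j'

/-- **the FAR row for two-caterpillar forests**: at every dominant layer `2j′ < T₁ + T₂`, `y ≤ P(N₁ + N₂ ≥ j′+1)`. [this work] -/
theorem tail_ge_lconv_heavyTop (M₁ M₂ : ℕ) (y : ℝ) (μ₁ μ₂ : ℕ → ℝ) (hy0 : 0 < y) (hy1 : y < 1)
    (h10 : ∀ h, 0 ≤ μ₁ h) (h1M : ∀ h, M₁ < h → μ₁ h = 0) (h11 : ∑ h ∈ Finset.range (M₁ + 1), μ₁ h = 1) (ht1 : y ≤ μ₁ M₁)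
    (h20 : ∀ h, 0 ≤ μ₂ h) (h2M : ∀ h, M₂ < h → μ₂ h = 0) (h21 : ∑ h ∈ Finset.range (M₂ + 1), μ₂ h = 1) (ht2 : y ≤ μ₂ M₂)
    (j' : ℕ) (hdom : (2 * j' : ℝ) < ∑ h ∈ Finset.range (M₁ + M₂ + 1), (h : ℝ) * lconv M₁ M₂ μ₁ μ₂ h) :
    y ≤ ∑ h ∈ Finset.Ico (j' + 1) (M₁ + M₂ + 1), lconv M₁ M₂ μ₁ μ₂ h :=
  tail_ge_of_decAt y j' (M₁ + M₂) _ hy1.le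
    (decAt_lconv_heavyTop M₁ M₂ y μ₁ μ₂ hy0 hy1 h10 h1M h11 ht1 h20 h2M h21 ht2 j') hdom

end LawDec

end Quant

end Summit.CriticalPhenomena.PercolationContinuityZ3.Theorems
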